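import Literature.NumberTheory.EllipticCurves.Rank1Residual.Typed.PAdicCertificateGoodOrdinary
import Literature.NumberTheory.EllipticCurves.Rank1Residual.Typed.CasselsLowerBound
import Literature.NumberTheory.EllipticCurves.Rank1Residual.Typed.HigherDescentCertificate
import Literature.NumberTheory.EllipticCurves.SelmerGroupCardinality
import Literature.NumberTheory.EllipticCurves.MazurTorsionGaloisStructureProofs
import Literature.NumberTheory.EllipticCurves.SkinnerUrban2014.PAdicUnitPeriodRatioProofs
import Literature.NumberTheory.EllipticCurves.Rank1Residual.X9NoEntry
import Literature.NumberTheory.EllipticCurves.Wuthrich2014.ThreeAdicImageSupersingularProofs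
import Summits.BirchSwinnertonDyer.Rank1Residual.Partition.Rows
import HarnessLib

/-!
# Row C16 at `p = 3` (scoreboard row D3) with `9 ∣ #Ш_an`, WITHOUT Beilinson–Flach and WITHOUT a
# partner: `BSD(E,3)` from an EXPLICIT `3`-DESCENT lower bound (`dim Sel^(3) > rank`) — rank zero with
# Wuthrich's upper bound, rank one with Kato's divisibility as the upper bound (cell `bsd-litref`,
# paper sub-dir `yz26`, seat `bsd-litref-yz26-pv`; LADDER-BSD H0/H1 · W7, row D3)

HONEST FRAMING (programme `BSD-LIT2PART-PROGRAMME-v1.md` §HONESTY, verbatim): «no tranche here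
proves BSD; ARM L moves the LITERAL column of an r ≤ 1 census into the
kernel-proved-modulo-named-print column; ARM P changes what «named print» is worth.» Theorems only:
no definition, no new named fact; every published theorem enters as one of the tree's EXISTING named
facts, taken as a hypothesis. PER CURVE (certificate-shaped inputs); NOT a class theorem; nothing
here changes a label or a verdict; the lane books.

## What and why

The three per-curve roads of the seat for row C16 = `RowC16 W 3` (Kato leading term,
`X10KatoCertificateRowC16.lean`, needs `3 ∤ #Ш_an`; Greenberg–Vatsal congruence transfer,
`X10CongruenceTransfer.lean`, needs a rank-`0` partner; visibility, `X10VisibilityRowC16.lean`,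
needs a rank-`2` congruent curve without local `3`-torsion) leave a residue of 82 rank-`0` classes
(all `9 ∣ #Ш_an`) and 73 rank-`1` classes (all `ord₃ #Ш_an = 2`). For BOTH the missing input is a
LOWER bound `Ш(E)[3] ≠ 0`, and an explicit `3`-descent (Schaefer–Stoll; the x11b engine of the
`b2b-bsdres` cell, whose Selmer elements are exact certificates: cube conditions verified in the
two étale algebras, support, local classes inside point-spanned local images, `3`-saturation by
cubic characters) delivers it as `3^{rank + 1} ∣ #Sel^(3)(E/ℚ)`, i.e. `dim_𝔽₃ Sel^(3) > rank E(ℚ)`: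
with `E(ℚ)[3] = 0` (automatic, `E[3]` irreducible) the descent count
`#Sel^(3) = 3^{rank} · #E(ℚ)[3] · #Ш[3]` (tree `card_selmerGroup_eq_pow_rank_mul`) forces `3 ∣ #Ш[3]`.

* `exists_sha_torsion_of_pow_succ_rank_dvd_card_selmer` — the count read as a lower bound (any
  number field, any prime): `#E(K)[p] = 1` and `p^{rank+1} ∣ #Sel^(p)` give a non-zero `x ∈ Ш(E/K)`
  with `p • x = 0`.
* `RowC16.bsdp_three_rankZero_of_selmer_certificate` — rank `0`, `ord₃ #Ш_an ≤ 2`, certificate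
  `3 ∣ #Sel^(3)(E/ℚ)`: Cassels–Tate squareness + Wuthrich 2014 Prop. 21
  (`Typed.bsdp_of_wuthrich_of_casselsTate_of_dvd`, the lever the x10 cell records as
  `X10.bsdp_three_rankZero_surj_of_casselsTate_of_three_dvd`), keyed to the row.
* `RowC16.padicValNat_shaOrder_le_of_kato_certificate` — rank `≤ 1`, Kato's divisibility
  (Thm. 17.4 (3)) + Perrin-Riou–Schneider (BMS 2016 Thm. 1.7) in the tree's ENGINE form
  `Typed.padicBSD_inequality_of_kato_of_surjective_pow`, with the period unit discharged by Mazur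
  1978 exactly as in `X10KatoCertificateRowC16.lean`: the COMPUTED inequality
  `v(ϖ·[T^r]L₃ · log₃(γ)^r · #tors²) ≤ v((1 − α⁻¹)² · ∏c_ℓ · Reg₃) + m` gives `ord₃ #Ш(E) ≤ m`.
* `RowC16.bsdp_three_rankOne_of_kato_of_selmer_certificate` — rank `1`, `ord₃ #Ш_an = 2`: the
  upper half from the previous theorem with `m = 2`, the lower half from the certificate
  `9 ∣ #Sel^(3)(E/ℚ)` (two independent exact Selmer elements) + Cassels–Tate; then Miller's last
  clause (`Typed.bsdp_of_missingPPartAt`).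

Named facts (all PUBLISHED, all already in the tree, `p = 3` inside every printed range):
`kato_divisibility` ([Kato2004Asterisque] Thm. 17.4 (3)), `Schneider1985_order_charGenerator_odd`
([BalakrishnanMullerStein2015] Thm. 1.7), `rank_eq_analyticRank_of_analyticRank_le_one` (GZK),
`mazur_not_dvd_maninConstant_of_odd` ([Mazur1978] Cor. 4.1), `exists_casselsTate_pairing`
([SilvermanAEC2009] Thm. X.4.14), `sha_dvd_analyticSha` ([Wuthrich2014] Prop. 21, rank `0` only),
`hasEntireLFunction_rat` (modularity, rank `0` only); Wuthrich's Lemma 20 is the tree THEOREM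
`lemma20_surjective_threeAdic_of_semistable_holds`. No Skinner–Urban, no Beilinson–Flach, no
Yan–Zhu, no Greenberg–Vatsal input; no partner curve.

References: [Kato2004Asterisque] Thm. 17.4 (3) (p. 273); [BalakrishnanMullerStein2015] Thm. 1.7;
[SteinWuthrich2013] §§3–4; [Mazur1978] Cor. 4.1; [Wuthrich2014] Prop. 21, Lemma 20; [SilvermanAEC2009]
Thm. X.4.2 (a), Thm. X.4.14; [SchaeferStoll2004] (the descent producing the certificate; not an input
of the kernel); [Miller2011LMS] Def. 1.1.
-/

set_option autoImplicit false

noncomputable section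

open scoped Classical MatrixGroups ModularForm

open CongruenceSubgroup WeierstrassCurve Literature.NumberTheory.EllipticCurves
  Literature.NumberTheory.EllipticCurves.ModularForms
  Literature.NumberTheory.EllipticCurves.Rank1Residual
  Literature.NumberTheory.EllipticCurves.Rank1Residual.Typed
  Literature.NumberTheory.EllipticCurves.Wuthrich2014

namespace Summit.BirchSwinnertonDyer.Rank1Residual

/-! ### The descent count read as a LOWER bound -/

section Count

variable {K : Type} [Field K] [NumberField K] (W : WeierstrassCurve K) [W.IsElliptic]
  (p : ℕ) [Fact p.Prime]

/-- **`dim Sel^(p) > rank ⇒ Ш[p] ≠ 0` (no rational `p`-torsion).** If `#E(K)[p] = 1` and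
`p^{rank E(K) + 1} ∣ #Sel^(p)(E/K)`, then `Ш(E/K)` has a non-zero element killed by `p`: by the descent
count `#Sel^(p) = p^{rank} · #E(K)[p] · #Ш[p]` (tree `card_selmerGroup_eq_pow_rank_mul`, Silverman
X.4.2 (a)) `p ∣ #Ш[p]`, so `Ш[p]` is not the trivial group. This is the shape in which an explicit
`p`-descent exhibiting `rank + 1` independent Selmer elements is consumed. [cite: SilvermanAEC2009, Thm. X.4.2 (a)] -/
theorem exists_sha_torsion_of_pow_succ_rank_dvd_card_selmer
    (htors : Nat.card (AddSubgroup.torsionBy W.toAffine.Point (p : ℤ)) = 1)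
    (hSel : p ^ (W.mordellWeilRank + 1) ∣ Nat.card (W.selmerGroup (p : ℤ))) :
    ∃ x : W.sha, x ≠ 0 ∧ p • x = 0 := by
  have hp : p.Prime := Fact.out
  haveI : NeZero p := ⟨hp.ne_zero⟩
  -- the count: `#Sel = p^rank · #E(K)[p] · #Ш[p]`
  have hcount := card_selmerGroup_eq_pow_rank_mul W p
  rw [htors, mul_one, ← card_torsionBy_sha_eq_card_inf] at hcount
  rw [hcount, pow_succ] at hSel
  have hdvd : p ∣ Nat.card (AddSubgroup.torsionBy W.sha ((p : ℕ) : ℤ)) :=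
    (Nat.mul_dvd_mul_iff_left (pow_pos hp.pos _)).mp hSel
  -- so `Ш[p] ≠ ⊥`
  by_contra hnone
  have hbot : AddSubgroup.torsionBy W.sha ((p : ℕ) : ℤ) = ⊥ := by
    rw [AddSubgroup.eq_bot_iff_forall]
    intro x hx
    by_contra hx0
    exact hnone ⟨x, hx0, AddSubgroup.torsionBy.nsmul_iff.mp hx⟩
  rw [hbot, AddSubgroup.card_bot] at hdvd
  exact hp.one_lt.ne' (Nat.dvd_one.mp hdvd)

end Count

section Curve

variable (W : WeierstrassCurve ℚ) [W.IsElliptic]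

/-- **No rational `p`-torsion under an irreducible mod-`p` representation**: `#E(ℚ)[p] = 1` (a
rational point of order `p` spans a `Γ_ℚ`-stable line; Mazur 1977, p. 157, in the tree as
`not_exists_addOrderOf_eq_of_hasIrreducibleModPGaloisRep`), stated for an arbitrary `DecidableEq ℚ`
instance on the point group. [cite: Mazur1977, Ch. III §5, p. 157] -/
theorem natCard_torsionBy_eq_one_of_irr (dec : DecidableEq ℚ) (p : ℕ) [Fact p.Prime]
    (hirr : Irr W p) :
    Nat.card (@AddSubgroup.torsionBy W.toAffine.Point
      (@WeierstrassCurve.Affine.Point.instAddCommGroup ℚ _ W.toAffine dec) (p : ℤ)) = 1 := by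
  -- (`DecidableEq ℚ` is a subsingleton: the statement serves every instance, in particular the
  -- classical one baked into the tree's descent count `card_selmerGroup_eq_pow_rank_mul`)
  obtain rfl : dec = instDecidableEqRat := Subsingleton.elim _ _
  rw [Nat.card_eq_one_iff_unique]
  refine ⟨⟨fun x y ↦ ?_⟩, ⟨0⟩⟩
  suffices hz : ∀ z : AddSubgroup.torsionBy W.toAffine.Point (p : ℤ), z = 0 by rw [hz x, hz y]
  intro z
  by_contra hz
  have hzp : p • (z : W.toAffine.Point) = 0 := AddSubgroup.torsionBy.nsmul_iff.mp z.2
  have hz0 : (z : W.toAffine.Point) ≠ 0 := fun h0 ↦ hz (Subtype.ext h0)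
  exact not_exists_addOrderOf_eq_of_hasIrreducibleModPGaloisRep W hirr
    ⟨z, addOrderOf_eq_prime hzp hz0⟩

variable [W.IsGloballyMinimal]

/-! ### Rank zero: Wuthrich's upper bound + the descent certificate -/

/-- **Row C16 ∩ {r_an = 0} at `p = 3` with `ord₃ #Ш_an ≤ 2`: `BSD(E,3)` from the `3`-descent
certificate `3 ∣ #Sel^(3)(E/ℚ)`** (one exact Selmer element; `E(ℚ)[3] = 0` from `E[3]` irreducible,
`E(ℚ)` finite of rank `0` by GZK, so `Ш(E)[3] ≠ 0`, `3 ∣ #Ш`; Cassels–Tate squareness gives `9 ∣ #Ш`,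
Wuthrich 2014 Prop. 21 the upper bound). Class hypothesis `RowC16 W 3` supplies "not additive at `3`"
and `surj(3)` (`surj_of_irr_of_ram` in the (ram) case); named facts `hCT`, `hW`, `hGZK`, `hmod` (all
PUBLISHED, all in the tree); per curve: `hr0`, the lane's `#Ш_an` (`hq`, `hv`) and the certificate
`hSel`. PER CURVE; NOT a class theorem. [cite: Wuthrich2014, Prop. 21 (p. 400)]
[cite: SilvermanAEC2009, Thm. X.4.14] [cite: SilvermanAEC2009, Thm. X.4.2 (a)]
[cite: Miller2011LMS, §1 and Def. 1.1] -/
theorem RowC16.bsdp_three_rankZero_of_selmer_certificate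
    (hCT : exists_casselsTate_pairing (K := ℚ)) (hW : sha_dvd_analyticSha)
    (hGZK : rank_eq_analyticRank_of_analyticRank_le_one) (hmod : hasEntireLFunction_rat)
    (h : RowC16 W 3) (hr0 : W.analyticRank = 0)
    {q : ℚ} (hq : shaAn W = (q : ℂ)) (hv : padicValRat 3 q ≤ 2)
    (hSel : 3 ∣ Nat.card (W.selmerGroup ((3 : ℕ) : ℤ))) : BSDp W 3 := by
  obtain ⟨-, hgo, hirr, hsr⟩ := h
  have hsurj : Surj W 3 := by
    rcases hsr with hs3 | hram
    · exact hs3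
    · exact surj_of_irr_of_ram W 3 hirr hram
  have hrk : W.mordellWeilRank = 0 := by rw [(hGZK W (by omega)).1, hr0]
  have hx : ∃ x : W.sha, x ≠ 0 ∧ (3 : ℕ) • x = 0 := by
    refine exists_sha_torsion_of_pow_succ_rank_dvd_card_selmer W 3 ?_
      (by rwa [hrk, zero_add, pow_one])
    exact natCard_torsionBy_eq_one_of_irr W _ 3 hirr
  exact bsdp_of_wuthrich_of_casselsTate_of_dvd W 3 hCT hW hGZK hmod (by decide) hr0
    (WeierstrassCurve.HasGoodReduction.not_hasAdditiveReduction _ hgo.1) (Or.inr hsurj) hq hv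
    (dvd_shaOrder_of_exists_torsion W 3 hx)

/-! ### Rank `≤ 1`: Kato's divisibility as the UPPER half, with an offset -/

/-- **Row C16 at `p = 3`, analytic rank `≤ 1`: `ord₃ #Ш(E/ℚ) ≤ m` from Kato's divisibility and the
computed leading-term INEQUALITY with offset `m`.** Same setting and inputs as
`RowC16.bsdp_three_of_kato_of_leadingTerm_certificate` (`X10KatoCertificateRowC16.lean`: `hS` BMS 2016
Thm. 1.7, `hGZK`, `hM` Mazur 1978 Cor. 4.1 for the period unit, `hK` Kato 2004 Thm. 17.4 (3) for this
curve, its newform `f` at level `N_E` and every cyclotomic datum; per curve `f`, `hf`, the period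
scalar `ϖ` with `ϖ · Ω_E = Ω⁺_f`, THE canonical `3`-adic height datum `Dh`, the computed order of
vanishing `hord`), but the certificate line is the INEQUALITY
`v(ϖ·[T^r]L₃(f, α) · log₃(γ)^r · #E(ℚ)_tors²) ≤ v((1 − α⁻¹)² · ∏c_ℓ · Reg₃(Dh)) + m` (`hcert`): the
engine inequality `ord₃ #Ш[3^∞] + v((1 − α⁻¹)²·∏c_ℓ·Reg₃) ≤ v([T^r]L₃ · log₃(γ)^r · #tors²)`
(`padicBSD_inequality_of_kato_of_surjective_pow`; `3`-adic surjectivity by Wuthrich's Lemma 20, a tree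
theorem; `ord₃ ϖ = 0` by `periodUnit_of_mazur`) then gives `ord₃ #Ш(E/ℚ) ≤ m` (`Ш` finite by GZK).
With `m = 0` this is the no-`3`-torsion certificate of the Kato road; with `m = ord₃ #Ш_an = 2` it is
the upper half for the 73 rank-one residue classes. PER CURVE; NOT a class theorem.
[cite: Kato2004Asterisque, Thm. 17.4 (3) (p. 273)] [cite: BalakrishnanMullerStein2015, Thm. 1.7]
[cite: SteinWuthrich2013, §§3–4] [cite: Mazur1978, Cor. 4.1] [cite: Wuthrich2014, Lemma 20 (p. 399)] -/
theorem RowC16.padicValNat_shaOrder_le_of_kato_certificate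
    (hS : Schneider1985_order_charGenerator_odd)
    (hGZK : rank_eq_analyticRank_of_analyticRank_le_one)
    (hM : mazur_not_dvd_maninConstant_of_odd)
    [NeZero (W.conductorNorm ℤ)] (f : CuspForm (Gamma0 (W.conductorNorm ℤ)) 2)
    (hK : ∀ (κ : ZpExtension ℚ 3) (γ : Field.absoluteGaloisGroup ℚ),
      kato_divisibility W 3 (κ := κ) (γ := γ) (f := f))
    (h : RowC16 W 3) (hf : IsNewformOf W f) (hr : W.analyticRank ≤ 1)
    (ϖ : ℚ) (hϖ : (ϖ : ℝ) * W.realPeriodRat = plusPeriod f)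
    (Dh : PAdicHeightData W 3) (hDh : Dh.IsCanonical)
    (hord : (padicLFunction f (unitRoot W 3 : ℚ_[3])).order = W.analyticRank)
    (m : ℕ)
    (hcert : (((ϖ : ℚ) : ℚ_[3]) *
          PowerSeries.coeff W.analyticRank (padicLFunction f (unitRoot W 3 : ℚ_[3])) *
          (padicLog 3 (cyclotomicGenerator 3) ^ W.analyticRank * (W.torsionOrder : ℚ_[3]) ^ 2)).valuation ≤
        ((1 - (unitRoot W 3 : ℚ_[3])⁻¹) ^ 2 * (W.tamagawaProduct : ℚ_[3]) *
          padicRegulator Dh).valuation + m) :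
    W.ShaFinite ∧ padicValNat 3 W.shaOrder ≤ m := by
  obtain ⟨-, hgo, hirr, hsr⟩ := h
  -- `surj(3)` on the row, then `3`-adic surjectivity (Wuthrich 2014 Lemma 20, a tree theorem)
  have hsurj : Surj W 3 := by
    rcases hsr with hs3 | hram
    · exact hs3
    · exact surj_of_irr_of_ram W 3 hirr hram
  have hsurjpow : ∀ n : ℕ, W.HasSurjectiveModNGaloisRep (3 ^ n : ℕ) :=
    lemma20_surjective_threeAdic_of_semistable_holds W (Or.inl hgo.1) hsurj
  -- the period scalar is a `3`-adic unit (Mazur 1978 Cor. 4.1) and non-zero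
  have hϖv : padicValRat 3 ϖ = 0 :=
    SkinnerUrban2014.periodUnit_of_mazur hM W 3 (by decide) hgo.1 hirr f hf ϖ hϖ
  have hΩf : 0 < plusPeriod f := IsNewform0.plusPeriod_pos_holds hf.1 hf.coeffField_eq_bot
  have hϖ0 : ϖ ≠ 0 := by
    intro h0
    rw [h0, Rat.cast_zero, zero_mul] at hϖ
    exact hΩf.ne' hϖ.symm
  have hϖQ : ((ϖ : ℚ) : ℚ_[3]) ≠ 0 := by exact_mod_cast hϖ0
  have hϖv' : ((ϖ : ℚ) : ℚ_[3]).valuation = 0 := by rw [Padic.valuation_ratCast, hϖv]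
  -- rank = analytic rank and `Ш` finite (GZK)
  obtain ⟨hrk, hfin⟩ := hGZK W hr
  haveI : Finite W.sha := hfin
  -- the engine inequality (Kato + Perrin-Riou–Schneider)
  obtain ⟨-, -, hle⟩ := padicBSD_inequality_of_kato_of_surjective_pow hS W 3 f hK (by decide) hgo.1
    hgo.2 hsurjpow hf Dh hDh (by rw [hrk]; exact hord)
  rw [hrk] at hle
  -- strip the unit `ϖ` from the certificate line
  have hcert' : (PowerSeries.coeff W.analyticRank (padicLFunction f (unitRoot W 3 : ℚ_[3])) *
        (padicLog 3 (cyclotomicGenerator 3) ^ W.analyticRank * (W.torsionOrder : ℚ_[3]) ^ 2)).valuation ≤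
      ((1 - (unitRoot W 3 : ℚ_[3])⁻¹) ^ 2 * (W.tamagawaProduct : ℚ_[3]) *
        padicRegulator Dh).valuation + m := by
    rw [← valuation_mul_eq_of_valuation_eq_zero 3 hϖQ hϖv', ← mul_assoc]
    exact hcert
  -- `ord₃ #Ш[3^∞] ≤ m`, and `ord₃ #Ш[3^∞] = ord₃ #Ш` for finite `Ш`
  have hprim : (padicValNat 3 (Nat.card (AddCommGroup.primaryComponent W.sha 3)) : ℤ) ≤ m := by
    linarith
  refine ⟨hfin, ?_⟩
  have h1 : padicValNat 3 (Nat.card (AddCommGroup.primaryComponent W.sha 3)) =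
      padicValNat 3 W.shaOrder := by
    rw [WeierstrassCurve.shaOrder, padicValNat_card_addPrimaryComponent]
  rw [← h1]
  exact_mod_cast hprim

/-! ### Rank one: Kato's upper half + the descent certificate + Cassels–Tate -/

/-- **Row C16 ∩ {r_an = 1} at `p = 3` with `ord₃ #Ш_an = 2`: `BSD(E,3)` from Kato's divisibility
(UPPER half, offset `2`) and the `3`-descent certificate `9 ∣ #Sel^(3)(E/ℚ)` (LOWER half).** Inputs:
as in `RowC16.padicValNat_shaOrder_le_of_kato_certificate` with `r_an = 1` substituted (the two
computed lines read `hord : ord_{T=0} L₃(f, α) = 1` and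
`hcert : v(ϖ·[T¹]L₃ · log₃(γ) · #tors²) ≤ v((1 − α⁻¹)² · ∏c_ℓ · Reg₃(Dh)) + 2` — the seat's two
L-engines and two regulator engines give EQUALITY with offset `2` on all 73 residue classes), plus
Cassels–Tate (`hCT`), the lane's exact `#Ш_an` of `3`-adic valuation `2` (`hq`, `hv`), and the
certificate `hSel : 9 ∣ #Sel^(3)(E/ℚ)` (two independent exact Selmer elements; with
`rank E(ℚ) = 1` and `E(ℚ)[3] = 0` this is `Ш(E)[3] ≠ 0`). Then `3 ∣ #Ш`, `#Ш` is a square, so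
`2 ≤ ord₃ #Ш ≤ 2 = ord₃ #Ш_an`: Miller's last clause (`bsdp_of_missingPPartAt`). Named facts: `hS`,
`hGZK`, `hM`, `hK`, `hCT` — all PUBLISHED, all in the tree. No Skinner–Urban / Beilinson–Flach /
Yan–Zhu / Greenberg–Vatsal input, no partner. PER CURVE; NOT a class theorem.
[cite: Kato2004Asterisque, Thm. 17.4 (3) (p. 273)] [cite: BalakrishnanMullerStein2015, Thm. 1.7]
[cite: Mazur1978, Cor. 4.1] [cite: SilvermanAEC2009, Thm. X.4.14] [cite: SilvermanAEC2009, Thm. X.4.2 (a)]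
[cite: Miller2011LMS, §1 and Def. 1.1] -/
theorem RowC16.bsdp_three_rankOne_of_kato_of_selmer_certificate
    (hS : Schneider1985_order_charGenerator_odd)
    (hGZK : rank_eq_analyticRank_of_analyticRank_le_one)
    (hM : mazur_not_dvd_maninConstant_of_odd)
    (hCT : exists_casselsTate_pairing (K := ℚ))
    [NeZero (W.conductorNorm ℤ)] (f : CuspForm (Gamma0 (W.conductorNorm ℤ)) 2)
    (hK : ∀ (κ : ZpExtension ℚ 3) (γ : Field.absoluteGaloisGroup ℚ),
      kato_divisibility W 3 (κ := κ) (γ := γ) (f := f))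
    (h : RowC16 W 3) (hf : IsNewformOf W f) (hr1 : W.analyticRank = 1)
    (ϖ : ℚ) (hϖ : (ϖ : ℝ) * W.realPeriodRat = plusPeriod f)
    (Dh : PAdicHeightData W 3) (hDh : Dh.IsCanonical)
    (hord : (padicLFunction f (unitRoot W 3 : ℚ_[3])).order = 1)
    (hcert : (((ϖ : ℚ) : ℚ_[3]) *
          PowerSeries.coeff 1 (padicLFunction f (unitRoot W 3 : ℚ_[3])) *
          (padicLog 3 (cyclotomicGenerator 3) * (W.torsionOrder : ℚ_[3]) ^ 2)).valuation ≤
        ((1 - (unitRoot W 3 : ℚ_[3])⁻¹) ^ 2 * (W.tamagawaProduct : ℚ_[3]) *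
          padicRegulator Dh).valuation + 2)
    {q : ℚ} (hq : shaAn W = (q : ℂ)) (hv : padicValRat 3 q = 2)
    (hSel : 3 ^ 2 ∣ Nat.card (W.selmerGroup ((3 : ℕ) : ℤ))) : BSDp W 3 := by
  have hirr : Irr W 3 := h.2.2.1
  -- UPPER half: `ord₃ #Ш ≤ 2`
  obtain ⟨hfin, hup⟩ := RowC16.padicValNat_shaOrder_le_of_kato_certificate W hS hGZK hM f hK h hf
    (le_of_eq hr1) ϖ hϖ Dh hDh (by rw [hr1]; exact_mod_cast hord) 2
    (by rw [hr1, pow_one]; exact_mod_cast hcert)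
  -- LOWER half: `Ш(E)[3] ≠ 0` from the descent certificate, then Cassels–Tate
  have hrk : W.mordellWeilRank = 1 := by rw [(hGZK W (by omega)).1, hr1]
  have hx : ∃ x : W.sha, x ≠ 0 ∧ (3 : ℕ) • x = 0 := by
    refine exists_sha_torsion_of_pow_succ_rank_dvd_card_selmer W 3 ?_ (by rwa [hrk])
    exact natCard_torsionBy_eq_one_of_irr W _ 3 hirr
  have hlow : MissingLowerBoundAt W 3 :=
    missingLowerBoundAt_of_casselsTate_of_pow_dvd W 3 hCT hfin hq (k := 1) (by rw [hv]; norm_num)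
      (by simpa using dvd_shaOrder_of_exists_torsion W 3 hx)
  have hupper : MissingUpperBoundAt W 3 := ⟨q, hq, by rw [hv]; exact_mod_cast hup⟩
  exact bsdp_of_missingPPartAt W 3 hGZK (le_of_eq hr1)
    (missingPPartAt_of_lower_of_upper W 3 hlow hupper)

end Curve

end Summit.BirchSwinnertonDyer.Rank1Residual

end
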